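import Mathlib
import Literature.NumberTheory.Sieve.Maynard2016Lemma7ErrorFinal
import Literature.NumberTheory.Sieve.Maynard2016Lemma7NormFactor
import Literature.NumberTheory.Sieve.Maynard2016LamSupport
import HarnessLib

/-!
# Maynard (2016), Lemma 7: the two proved halves in the binder shape of `Lemma7Tuple`

Topic `Literature/NumberTheory/Sieve`; trunk AntSieve / parity (Maynard 2016 large-gaps ladder, named
fact `Literature.NumberTheory.Sieve.Maynard2016.Lemma7Tuple` of `Maynard2016Lemma7PerTuple.lean`).

J. Maynard, *Large gaps between primes*, Ann. of Math. (2) 183 (2016), 915–933 = arXiv:1408.5110,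
§6, proof of Lemma 7.  The named fact `Lemma7Tuple` quantifies over `m` (`1 ≤ m`, `m` even, `m`
small), an interval `[A, B] ⊆ [x/2, x]`, a prime `p₀ ∈ 𝓡_m` in the window
`h_i x < p₀ < U/m − h_i x` and an index `i`.  This file restates the two halves of the proof that are
already in the tree in exactly that shape, discharging the bookkeeping hypotheses from `p₀ ∈ 𝓡_m`
and the window:

* `facts_of_mem_Rm_of_window`: `p₀ ∈ 𝓡_m` and `h_i x < p₀` give `p₀` prime, `x < p₀`,
  `(m p₀ − 1, P_y) = 1`, and `h_i q < p₀` for every `q ∈ 𝓘 = intervalPrimes A B` with `B ≤ x`;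
* **`lemma7_errorHalf`** (the error-term half (6.27)–(6.31), from
  `Maynard2016Lemma7ErrorFinal.exists_eventually_abs_sum_divSum_sq_sub_le`):
  `∃ C, ∀ᶠ x, ∀ m ≥ 1, ∀ x/2 ≤ A ≤ B ≤ x, ∀ p₀ ∈ 𝓡_m, ∀ i, h_i x < p₀ →
   |∑_{q ∈ 𝓘} divSum(q)(p₀ − h_i q)² − #𝓘 · S_i| ≤ C x/(log x)^A`;
* **`lemma7_normHalf`** (the `q`-uniform normalisation (6.23)–(6.25), from
  `Maynard2016Lemma7NormFactor.eventually_sum_div_normMain_ge`): for `C_U > 0`,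
  `∀ᶠ x, ∀ m even, I₁, I₂ > 0 → ∀ x/2 ≤ A ≤ B, ∀ p₀ i,
   K_m (2 − e^{24k²/(w+1)}) (∑_{q∈𝓘} T − ∑_{(a,b)} ∑_{w<p≤y, p∤m} p⁻¹ ∑_{q∈𝓘, p ∣ m q(h_b−h_a)−1} T)
     ≤ ∑_{q∈𝓘} T(q)/M_{m,q}` with `T(q) = divSum(q)(p₀ − h_i q)²`.

What remains for `Lemma7Tuple` after this file is the main-term engine for `S_i = solvSum`
(`Maynard2016Lemma7CoupledLink`, `Maynard2016Lemma7RadLcm`) and the assembly.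

## References

* J. Maynard, *Large gaps between primes*, Ann. of Math. (2) 183 (2016), 915–933; arXiv:1408.5110,
  §6, proof of Lemma 7. [Maynard2016LargeGaps]
-/

noncomputable section

open Finset Filter Real
open scoped BigOperators Classical Topology

namespace Literature.NumberTheory.Sieve

namespace Maynard2016

variable {k : ℕ}

/-! ### Bookkeeping from `p₀ ∈ 𝓡_m` and the window -/

/-- From `p₀ ∈ 𝓡_m` and the window `h_i x < p₀`: `p₀` is prime, `x < p₀`, `(m p₀ − 1, P_y) = 1`, and
`h_i q < p₀` for all `q ∈ intervalPrimes A B` whenever `B ≤ x`. [cite: Maynard2016LargeGaps, Lemma 7 (proof, p. 12, "since x/2 < q < p₀")] -/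
theorem facts_of_mem_Rm_of_window {C_U ε : ℝ} {x m p₀ : ℕ} {i : Fin k} (hp₀ : p₀ ∈ Rm C_U ε x m)
    (hwin : (hTuple k x i : ℝ) * x < p₀) :
    p₀.Prime ∧ x < p₀ ∧ Nat.Coprime (m * p₀ - 1) (primorial ⌊y ε x⌋₊) ∧
      ∀ A B : ℝ, B ≤ x → ∀ q ∈ intervalPrimes A B, hTuple k x i * q < p₀ := by
  obtain ⟨hp, -, hcop, -⟩ := prime_and_coprime_of_mem_Rm hp₀
  have h1 : (1 : ℝ) ≤ hTuple k x i := by exact_mod_cast one_le_hTuple k x i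
  have hx0 : (0 : ℝ) ≤ x := Nat.cast_nonneg _
  refine ⟨hp, ?_, hcop, fun A B hBx q hq => ?_⟩
  · have : (x : ℝ) < p₀ := by nlinarith
    exact_mod_cast this
  · by_cases hB : 0 ≤ B
    · have hqB : (q : ℝ) ≤ B := ((mem_intervalPrimes hB).1 hq).2.2
      have : ((hTuple k x i * q : ℕ) : ℝ) < p₀ := by
        push_cast
        nlinarith
      exact_mod_cast this
    · exfalso
      rw [not_le] at hB
      have hq' := (Finset.mem_filter.1 hq).1
      rw [Finset.mem_Icc] at hq'
      have hfl : ⌊B⌋₊ = 0 := Nat.floor_of_nonpos hB.le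
      have hq0 : q = 0 := by omega
      exact Nat.not_prime_zero (hq0 ▸ (Finset.mem_filter.1 hq).2)

/-! ### The error-term half in the shape of `Lemma7Tuple` -/

/-- **The error-term half of Lemma 7 ((6.27)–(6.31)) in the binder shape of `Lemma7Tuple`.**
[cite: Maynard2016LargeGaps, Lemma 7 (proof, displays (6.27)–(6.31))] -/
theorem lemma7_errorHalf {J : ℕ} {c : Fin J → ℝ} {Fd : Fin k → Fin J → ℝ → ℝ} {G : ℝ → ℝ}
    (hD : IsSieveData k J c Fd G) (C_U : ℝ) {ε : ℝ} (hε0 : 0 ≤ ε) (hε : ε ≤ 1 / 2) {A : ℝ}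
    (hA : 0 < A) :
    ∃ C : ℝ, ∀ᶠ x : ℕ in atTop, ∀ m : ℕ, 1 ≤ m → ∀ A' B' : ℝ, (x : ℝ) / 2 ≤ A' → A' ≤ B' →
      B' ≤ x → ∀ p₀ ∈ Rm C_U ε x m, ∀ i : Fin k, (hTuple k x i : ℝ) * x < p₀ →
        |∑ q ∈ intervalPrimes A' B', divSum c Fd G ε x m q (p₀ - hTuple k x i * q) ^ 2 -
            ((intervalPrimes A' B').card : ℝ) * solvSum c Fd G ε x m p₀ i| ≤
          C * x / Real.log x ^ A := by
  obtain ⟨C, hC⟩ := exists_eventually_abs_sum_divSum_sq_sub_le hD hε0 hε hA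
  refine ⟨C, ?_⟩
  filter_upwards [hC, eventually_ge_atTop 2] with x hx hx2 m hm A' B' hA' hAB hBx p₀ hp₀ i hwin
  obtain ⟨hp, hxp, hcop, hQ⟩ := facts_of_mem_Rm_of_window hp₀ hwin
  have hx2' : (2 : ℝ) ≤ x := by exact_mod_cast hx2
  exact hx m p₀ hm hp hxp hcop i A' B' (by linarith) hAB hBx (hQ A' B' hBx)

/-! ### The normalisation half in the shape of `Lemma7Tuple` -/

/-- `U > 0` for all large `x` when `C_U > 0` and `0 ≤ ε ≤ 1/2`. [cite: Maynard2016LargeGaps, §2 display (2.3)] -/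
theorem eventually_U_pos {C_U : ℝ} (hCU : 0 < C_U) {ε : ℝ} (hε0 : 0 ≤ ε) (hε : ε ≤ 1 / 2) :
    ∀ᶠ x : ℕ in atTop, 0 < U C_U ε x := by
  filter_upwards [eventually_lemma7_sideConditions hε0 hε, eventually_iteratedLogs] with x hx hL
  exact U_pos hCU (by omega) hx.2.2.1 (by linarith [hL.2.1])

/-- **The `q`-uniform normalisation of Lemma 7 ((6.23)–(6.25)) in the binder shape of `Lemma7Tuple`**,
with `T(q) = divSum(q)(p₀ − h_i q)²` on `𝓘 = intervalPrimes A B ⊆ [x/2, ∞)`.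
[cite: Maynard2016LargeGaps, Lemma 7 (proof, displays (6.23)–(6.25))] -/
theorem lemma7_normHalf {J : ℕ} (cj : Fin J → ℝ) (Fd : Fin k → Fin J → ℝ → ℝ) (G : ℝ → ℝ)
    {C_U : ℝ} (hCU : 0 < C_U) {ε : ℝ} (hε0 : 0 ≤ ε) (hε : ε ≤ 1 / 2) (hk0 : 0 < k) :
    ∀ᶠ x : ℕ in atTop, ∀ m : ℕ, Even m → 0 < I1 cj Fd → 0 < I2 k G →
      ∀ A' B' : ℝ, (x : ℝ) / 2 ≤ A' → A' ≤ B' → ∀ p₀ : ℕ, ∀ i : Fin k,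
        (m : ℝ) * ((Real.log x) ^ k * (Real.log (y ε x)) ^ k) * Pw x /
              (U C_U ε x * classCount x m * singSmall k x * I1 cj Fd * I2 k G * mPart k ε x m) *
            ((2 - Real.exp (24 * (k : ℝ) ^ 2 / (⌊wFun x⌋₊ + 1))) *
              (∑ q ∈ intervalPrimes A' B', divSum cj Fd G ε x m q (p₀ - hTuple k x i * q) ^ 2 -
                ∑ ab : Fin k × Fin k, ∑ p ∈ (midPrimes ε x).filter (fun p => ¬ p ∣ m),
                  (1 : ℝ) / p *
                    ∑ q ∈ (intervalPrimes A' B').filter (fun q : ℕ =>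
                      (p : ℤ) ∣ (m : ℤ) * q * ((hTuple k x ab.2 : ℤ) - hTuple k x ab.1) - 1),
                      divSum cj Fd G ε x m q (p₀ - hTuple k x i * q) ^ 2)) ≤
          ∑ q ∈ intervalPrimes A' B',
            divSum cj Fd G ε x m q (p₀ - hTuple k x i * q) ^ 2 / normMain cj Fd G C_U ε x m q := by
  filter_upwards [eventually_sum_div_normMain_ge cj Fd G C_U hε0 hε hk0, eventually_U_pos hCU hε0 hε]
    with x hx hU m hm hI1 hI2 A' B' hA' hAB p₀ i
  have hx0 : (0 : ℝ) ≤ (x : ℝ) / 2 := by positivity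
  have hQ : ∀ q ∈ intervalPrimes A' B', q.Prime ∧ (x : ℝ) / 2 ≤ q := fun q hq => by
    have h := (mem_intervalPrimes (by linarith : (0 : ℝ) ≤ B')).1 hq
    exact ⟨h.1, hA'.trans h.2.1⟩
  exact hx m hm hU hI1 hI2 (intervalPrimes A' B') hQ
    (fun q => divSum cj Fd G ε x m q (p₀ - hTuple k x i * q) ^ 2) (fun q => sq_nonneg _)

end Maynard2016

end Literature.NumberTheory.Sieve

end
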